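import Summits.ResolutionOfSingularities.ResolutionOfSingularities.Theorems.KangarooTowers
import HarnessLib

/-!
# KangarooCutCells — decomp-res node «KangarooCut» (lens-4 g24, critic rows 148/148a), tree file 4/5 of the node

Content VERBATIM from the decomp-res lens-4 g24 TREE-FACING COMPANION
`HOME/decomp-res-lens-4/g24/tree/KangarooCutTree.lean` (sha256 76e53063…, 770 l;
HOME = run/shared/lean/pub/decomp-res) = the NEW PART §60–§63 of the node
`HOME/decomp-res-lens-4/g24/KangarooCut.lean` (pin f422af60, l. 1026–1759, byte-identical);
the node's carried g23 block «FrobeniusForm» is ALREADY in the tree as `Theorems/FrobeniusGain` ·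
`PPowerFormLucas` · `PPowerForm` · `PPowerTowers` and is not
landed again.  Critic: CRITIC-LEDGER rows 148 (CLEARED, DECIDED +1: the jump-free bed ⊆ `ContactHugging`) and 148a
(the companion = the landing unit); landing
order 2026-08-30T22:00:50Z / 22:19:25Z.  Landed by decomp-res writer g8 in the lens's namespace
`…Theorems.HugValuationCut`, split CONE-AWARE for the
400-line limit: `PPowerSpan` (§60) · `KangarooTransport` (§61) · `KangarooTowers` (§62) · `KangarooCutCells`
(§63 minus the three 31571 up-links) are
OUTSIDE the Theses cone (importable by the route file); `MaxContactCutKangarooCut` (§63's three `_of_item` up-links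
from `MaxContactCut.NoContactHuggingTowers`)
is the in-cone wiring file.  All `--supports stmt-ResolutionOfSingularities-28338`.  Aside bookkeeping (critic row
148 / rider 22:00:50Z (3)): exactly ONE
successor aside `NoWildKangarooOffLocusTowers` (home `KangarooCutCells`) SUPERSEDES 28338
`LCNoWildContactFreeOffLocusTowers` once this node and
`Theorems/ContactFreeIsPPower` (lens-6 g19 companion, every-field iff `noWildContactFreeOffLocusTowers_iff_pPower`)
are both in the tree — exactness chain
`noWildContactFreeOffLocusTowers_iff_pPower` + `noWildPPowerOffLocusTowers_iff_kangaroo (h31571)`.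

§63 (companion l. 634–765), CONE-FREE PART: the cells `WildPPowerJumpFreeOffLocusTowersTerminate` (DECIDED) /
`WildKangarooOffLocusTowersTerminate`
(THE LOCATED RESIDUAL after g24 · UNDECIDED · IDEA-NEEDED), the exact splits `noTowerWild_split_jumpFree`,
`wildPPowerOffLocus_iff_g24`,
`wildPPowerOffLocus_iff_kangaroo (h)`, the letter forms, BY NAME `NoWildPPowerJumpFreeOffLocusTowers` /
`NoWildKangarooOffLocusTowers` (= the successor
aside's statement), `noWildPPowerOffLocusTowers_iff_g24`, `noWildKangarooOffLocusTowers_of_g23`,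
`noWildKangarooOffLocusTowers_of_aside`,
`noWildContactFreeOffLocusTowers_iff_g24`.  Imports `KangarooTowers`.  Cone-free (the three up-links from 31571 are
in `MaxContactCutKangarooCut`).

[WRITER NOTE (decomp-res writer g8): section split only; namespace, universes, section variables and every
declaration exactly as in the companion
(global `set_option` dropped; the cone import `MaxContactCutTameCut` of the companion is replaced in the cone-free
files by the cone-free homes of what the
proofs use: `AbsoluteGiraudKernel` (`AbsoluteContactClasses.point_round_chart`),
`FrobeniusLadderFInjectiveMacaulayficationCentreSpread` (`centreSpread`),
`PPowerTowers`, `TameCutStage`, `LatencyCutCells`; the `open …Theses` line lives only in the wiring file).]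

(Sources: Hauser2010Kangaroo; Moh1987; Hironaka1970Additive; Giraud1975; CossartPiltant2008 Prop. 4.2;
CossartPiltant2019 Prop. 2.50; EGA IV₄ 16.11.2.)
-/

noncomputable section

open CategoryTheory AlgebraicGeometry IsLocalRing
open Literature.AlgebraicGeometry.Resolution
open Summit.ResolutionOfSingularities.ResolutionOfSingularities.Theorems
open WeakOrderReduction ForcedTowerClasses DivergentTowerClasses MonomialTowerClasses
open HugDimensionClasses HugDimensionKernels SurfaceShadowClasses SurfaceShadowKernels
open NearPointCut (SingularClass)
open AbsoluteContactClasses (IsAbsContactAt SepResidueAt diffIdeal_restrict_le stalkMap_comp_toStalk_eq_stalkHom)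
open scoped BigOperators

namespace Summit.ResolutionOfSingularities.ResolutionOfSingularities.Theorems.HugValuationCut

/-! ## §63 (g24 · NEW) THE CUT OF THE g23 LOCATED RESIDUAL BY THE KANGAROO LAW — cells and EXACT re-locations BY NAME

`WildPPowerOffLocusTowersTerminate n` (g23: wild, off-locus singular class, `p`-power form at every marked point) ⟺
(EVENTUALLY JUMP-FREE bed — DECIDED: ⊆ `ContactHugging` by `contactHugging_of_eventuallyJumpFree`, hence settled by
`ContactHuggingTowersTerminate n` / 31571 BY NAME, no port) ∧ (KANGAROO-RECURRENT bed — THE LOCATED RESIDUAL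
after g24: a typed
kangaroo jump interrupts EVERY germ from EVERY stage; by `exists_wInv_every_stage_of_pPowerTower` this is, at weight `p` over a
perfect field, literally «infinitely many kangaroo jumps along every weak-contact hypersurface», and at the
weights `2p, 3p, …`
it contains the towers whose `p`-power forms are `p`-th powers of forms of HIGHER degree — no linear weak contact at all). -/

section KangarooCells

/-- **CELL (O, wild, `p`-power, EVENTUALLY JUMP-FREE)** — DECIDED (31571's class by `contactHugging_of_eventuallyJumpFree`;
census profile: every weight-`p` chain of T-wild-in / T-kangO-deep whose recorded initial form stays `y^p` in the transported
coordinate at every `p`-power node, e.g. 3:R11L:y³+x²y²+x⁴y²:ROFF0:20 with in₃ = y³, y³, y³). -/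
def WildPPowerJumpFreeOffLocusTowersTerminate (n : ℕ) : Prop :=
  NoTowerWild n fun T => ((SingularClass T ∧ Nonempty (MarkedShadow T n)) ∧ PPowerTower n T) ∧ EventuallyJumpFree n T

/-- **CELL (O, wild, `p`-power, KANGAROO-RECURRENT) · THE LOCATED RESIDUAL after g24** — UNDECIDED · IDEA-NEEDED
(a law bounding
the number of kangaroo jumps: Moh's bound on the residual order / Hauser's arithmetic of kangaroo points /
Cossart–Piltant's `ω`;
census profile: 2:R3L:y²+x⁵+x⁴u³:ROFF1:5, `(p, n) = (2, 4)`, in₄ = x²y², y²u²+x²y², y²u² — squares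
of quadrics, no linear weak
contact at any replayed node). -/
def WildKangarooOffLocusTowersTerminate (n : ℕ) : Prop :=
  NoTowerWild n fun T => ((SingularClass T ∧ Nonempty (MarkedShadow T n)) ∧ PPowerTower n T) ∧ ¬ EventuallyJumpFree n T

/-- **KERNEL (pure logic): every class splits EXACTLY by `EventuallyJumpFree`.** [folklore] -/
theorem noTowerWild_split_jumpFree {n : ℕ} (P : ForcedTower → Prop) :
    NoTowerWild n P ↔
      NoTowerWild n (fun T => P T ∧ EventuallyJumpFree n T) ∧ NoTowerWild n (fun T => P T ∧ ¬ EventuallyJumpFree n T) := by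
  refine ⟨fun h => ⟨noTowerWild_mono (fun _ h' => h'.1) h, noTowerWild_mono (fun _ h' => h'.1) h⟩, ?_⟩
  rintro ⟨h₁, h₂⟩ p hp hpn K _ _ T g hB hD hE hP
  by_cases hJ : EventuallyJumpFree n T
  · exact h₁ p hp hpn K T g hB hD hE ⟨hP, hJ⟩
  · exact h₂ p hp hpn K T g hB hD hE ⟨hP, hJ⟩

/-- **KERNEL (PROVED, no port): the eventually jump-free column of EVERY class is settled by `ContactHuggingTowersTerminate n`**
(31571 at the weight). [folklore] -/
theorem noTowerWild_jumpFree_of_contact {n : ℕ} (P : ForcedTower → Prop) (h : ContactHuggingTowersTerminate n) :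
    NoTowerWild n fun T => P T ∧ EventuallyJumpFree n T :=
  noTowerWild_mono (fun _ hT => contactHugging_of_eventuallyJumpFree hT.2) (noTowerWild_of_noTower h)

/-- **EXACT (pure logic): the g23 located residual = the eventually jump-free bed ∧ the kangaroo-recurrent bed.**
[folklore] -/
theorem wildPPowerOffLocus_iff_g24 {n : ℕ} :
    WildPPowerOffLocusTowersTerminate n ↔
      WildPPowerJumpFreeOffLocusTowersTerminate n ∧ WildKangarooOffLocusTowersTerminate n :=
  noTowerWild_split_jumpFree _

/-- **KERNEL (PROVED, no port): (O, wild, `p`-power, eventually jump-free) terminates as soon as 31571 does at the weight.**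
[folklore] -/
theorem wildPPowerJumpFree_of_contact {n : ℕ} (h : ContactHuggingTowersTerminate n) :
    WildPPowerJumpFreeOffLocusTowersTerminate n :=
  noTowerWild_jumpFree_of_contact _ h

/-- **EXACT GIVEN 31571 at the weight: the g23 residual ⟺ the kangaroo-recurrent bed.** [folklore] -/
theorem wildPPowerOffLocus_iff_kangaroo {n : ℕ} (h : ContactHuggingTowersTerminate n) :
    WildPPowerOffLocusTowersTerminate n ↔ WildKangarooOffLocusTowersTerminate n := by
  rw [wildPPowerOffLocus_iff_g24]
  exact ⟨fun h' => h'.2, fun h' => ⟨wildPPowerJumpFree_of_contact h, h'⟩⟩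

/-- the kangaroo-recurrent bed is a sub-residual of g23's (hypothesis-free). [folklore] -/
theorem wildKangaroo_of_wildPPowerOffLocus {n : ℕ} (h : WildPPowerOffLocusTowersTerminate n) :
    WildKangarooOffLocusTowersTerminate n :=
  (wildPPowerOffLocus_iff_g24.mp h).2

/-- **THE DECIDED CELL IN CENSUS LETTERS (EXACT, KERNEL)**: (O, wild, `p`-power, eventually jump-free) ⟺ (O, wild, `p`-power,
eventually SHAPE-STABLE: «in_n = c̄·Z^n in the transported coordinate at every replayed node from some stage
on») — the letter
upgrade `jumpFreeFrom_iff_shapeStableFrom` inside the class binders. [folklore] -/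
theorem wildPPowerJumpFree_iff_letter {n : ℕ} (hn : 1 ≤ n) :
    WildPPowerJumpFreeOffLocusTowersTerminate n ↔
      NoTowerWild n fun T =>
        ((SingularClass T ∧ Nonempty (MarkedShadow T n)) ∧ PPowerTower n T) ∧ EventuallyShapeStable n T :=
  ⟨fun h p hp hpn K _ _ T g hB hD hE hP =>
      h p hp hpn K T g hB hD hE ⟨hP.1, (eventuallyJumpFree_iff_eventuallyShapeStable T g hB hn hD).mpr hP.2⟩,
    fun h p hp hpn K _ _ T g hB hD hE hP =>
      h p hp hpn K T g hB hD hE ⟨hP.1, (eventuallyJumpFree_iff_eventuallyShapeStable T g hB hn hD).mp hP.2⟩⟩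

/-- **THE RESIDUAL CELL IN CENSUS LETTERS (EXACT, KERNEL)**: kangaroo-recurrent ⟺ NOT eventually shape-stable. [folklore] -/
theorem wildKangaroo_iff_letter {n : ℕ} (hn : 1 ≤ n) :
    WildKangarooOffLocusTowersTerminate n ↔
      NoTowerWild n fun T =>
        ((SingularClass T ∧ Nonempty (MarkedShadow T n)) ∧ PPowerTower n T) ∧ ¬ EventuallyShapeStable n T :=
  ⟨fun h p hp hpn K _ _ T g hB hD hE hP =>
      h p hp hpn K T g hB hD hE
        ⟨hP.1, fun hJ => hP.2 ((eventuallyJumpFree_iff_eventuallyShapeStable T g hB hn hD).mp hJ)⟩,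
    fun h p hp hpn K _ _ T g hB hD hE hP =>
      h p hp hpn K T g hB hD hE
        ⟨hP.1, fun hS => hP.2 ((eventuallyJumpFree_iff_eventuallyShapeStable T g hB hn hD).mpr hS)⟩⟩

/-- BY NAME: **no wild `p`-power off-locus tower with finitely many kangaroo jumps** (DECIDED by 31571). -/
def NoWildPPowerJumpFreeOffLocusTowers : Prop := ∀ n : ℕ, 1 ≤ n → WildPPowerJumpFreeOffLocusTowersTerminate n

/-- BY NAME: **no wild KANGAROO-RECURRENT off-locus tower** — THE LOCATED RESIDUAL of the aside chain
`NoWildContactFreeOffLocusTowers ⊇ NoWildPPowerOffLocusTowers ⊇ ·` after g24. -/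
def NoWildKangarooOffLocusTowers : Prop := ∀ n : ℕ, 1 ≤ n → WildKangarooOffLocusTowersTerminate n

/-- **EXACT RE-LOCATION BY NAME (pure logic): the g23 residual ⟺ (jump-free bed) ∧ (kangaroo-recurrent bed).** [folklore] -/
theorem noWildPPowerOffLocusTowers_iff_g24 :
    NoWildPPowerOffLocusTowers ↔ NoWildPPowerJumpFreeOffLocusTowers ∧ NoWildKangarooOffLocusTowers :=
  ⟨fun h => ⟨fun n hn => (wildPPowerOffLocus_iff_g24.mp (h n hn)).1, fun n hn => (wildPPowerOffLocus_iff_g24.mp (h n hn)).2⟩,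
    fun h n hn => wildPPowerOffLocus_iff_g24.mpr ⟨h.1 n hn, h.2 n hn⟩⟩

/-- the kangaroo-recurrent bed is implied by the g23 residual, hence by the tree aside (up-links for the writer). [folklore] -/
theorem noWildKangarooOffLocusTowers_of_g23 (h : NoWildPPowerOffLocusTowers) : NoWildKangarooOffLocusTowers :=
  (noWildPPowerOffLocusTowers_iff_g24.mp h).2

/-- up-link from the TREE aside `NoWildContactFreeOffLocusTowers` (`Theorems/LatencyCutCells`). [folklore] -/
theorem noWildKangarooOffLocusTowers_of_aside (h : NoWildContactFreeOffLocusTowers) : NoWildKangarooOffLocusTowers :=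
  noWildKangarooOffLocusTowers_of_g23 (noWildPPowerOffLocusTowers_of_aside h)

/-- **THE FULL CHAIN, EXACT BY NAME (g23 + g24): the tree aside `NoWildContactFreeOffLocusTowers` ⟺ (jump-free
bed: ⟸ 31571) ∧
(kangaroo-recurrent bed: RESIDUAL) ∧ (contact-free non-`p`-power bed: perfect and f.g. columns EMPTY, g23).** [folklore] -/
theorem noWildContactFreeOffLocusTowers_iff_g24 :
    NoWildContactFreeOffLocusTowers ↔
      (NoWildPPowerJumpFreeOffLocusTowers ∧ NoWildKangarooOffLocusTowers) ∧ NoWildContactFreeNonPPowerOffLocusTowers := by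
  rw [noWildContactFreeOffLocusTowers_iff_g23, noWildPPowerOffLocusTowers_iff_g24]

end KangarooCells

end Summit.ResolutionOfSingularities.ResolutionOfSingularities.Theorems.HugValuationCut
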